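import Summits.HodgeConjecture.CorCM.GaloisIndexTwoDoubledTypes
import Summits.HodgeConjecture.CorCM.GaloisTwoHalvesCyclicFibres
import HarnessLib

/-!
# `(C₄ ⋊ C₄) × C_n` (`n ≥ 3`) with `c ∈ {x², x²y²}` is BAD: a NON-split doubled type via the index-two criterion `c ∉ ⟨y²⟩`

COR-CM (cell `pub-hodgecm2`), binder seat b04 (gen 29), count-neutral own lane «Galois-CM-type classification» (which Galois CM
fields `(G, c)` have ALL primitive CM types nondegenerate = GOOD, vs. a primitive degenerate type = BAD).  KERNEL ONLY: theorems;
no definition, no named fact, no `sorry`.  `HC_CM` is neither used nor claimed.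

SETTING.  `C₄ ⋊ C₄ = ⟨x⟩ ⋊ ⟨y⟩` (`y x y⁻¹ = x⁻¹`), presented as `Multiplicative (ZMod 4) ⋊[φ] Multiplicative (ZMod 4)` with
`φ(1) = (·)⁻¹`; it has NO involution outside its index-two abelian subgroups (`(xⁱyʲ)² = y²` for `j` odd), so the split-involution
theorem does not apply — but the INDEX-TWO CRITERION of `CorCM/GaloisIndexTwoDoubledTypes` does: take `A = ⟨x⟩ × ⟨y²⟩ ≅ ℤ/4 × ℤ/2`
(coordinates `(t, s) ↔ xᵗ y²ˢ`), `z = y ∉ A`, `z² = y² = q ↔ (0,1)`, `θ = conj_y = (−1, id)` on `A`; the central involutions are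
`x² ↔ (2,0)`, `y² ↔ (0,1)`, `x²y² ↔ (2,1)`, and **`c ∉ ⟨q⟩` exactly for `c ∈ {x², x²y²}`**.  Times `C_n`: `A × ℤ/n`, `θ = (−1, id, id)`.
* §1 `exists_simple_degenerate_fourSemidirectFour_times_cyclic_of_half`: `Gal(K/ℚ) ≅ (C₄ ⋊ C₄) × C_n`, `c = (x² y^{2s₀}, 1)` (`s₀ ∈ ℤ/2`),
  plus an aperiodic `θ`-asymmetric CM half of `(ℤ/4 × ℤ/2) × ℤ/n` (decidable predicate) ⟹ BAD (simple degenerate CM `8n`-fold).  The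
  embedding `i(t,s,v) = (xᵗ y²ˢ, v)` is a homomorphism because `φ(y²) = id` (`φ(y)² = inv² = 1`).
* §2 ALL DEGREES (`n ≥ 3`; two-halves fibre construction of `CorCM/GaloisTwoHalvesCyclicFibres`, pairs of halves of `ℤ/4 × ℤ/2` from
  `scratch-g29/twohalves.py`, the finite hypotheses by `decide` inside `ℤ/4 × ℤ/2`): **`(C₄ ⋊ C₄) × C_n` is BAD for `c = x²` and for
  `c = x²y²`, every `n ≥ 3`**.  The third involution `c = y²` (`= z²` for every `z ∉ A`, but `∉ ⟨x²⟩` for `A' = ⟨x², y⟩`, `z = x`) is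
  left to the same method with the other abelian subgroup.  At `n = 1` all three are BAD already (gen 17 census; Weil-type
  certificates `CorCM/GaloisSixteenDegenerateTables*`).

## References

* [Kubota1965] T. Kubota, *On the field extension by complex multiplication*, Trans. AMS 118 (1965), §2, §4 Lemma 2.
* [Shimura1998] G. Shimura, *Abelian Varieties with Complex Multiplication and Modular Functions*, §6.2 Thm. 3, §8.2 Prop. 26.
* [Gordon1999HodgeAVSurvey] B. B. Gordon, *A survey of the Hodge conjecture for abelian varieties*, Thm. 6.4, §9.3.
-/

noncomputable section

open CategoryTheory CategoryTheory.Limits NumberField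
open scoped BigOperators

namespace Summit.HodgeConjecture.CorCM.SplitInvolution

open Literature.NumberTheory.ComplexMultiplication
open Literature.AlgebraicGeometry.Motives (AbelianVariety CMType)
open Literature.AlgebraicGeometry.HodgeTheory
open Literature.AlgebraicGeometry.ComplexMultiplication (IsCMTypeRealisation)
open Literature.AlgebraicGeometry.Pohlmann1968
open Literature.Barriers.HodgeConjecture (divisorClassesSpan)

/-! ## §1 The non-split doubled type in `(C₄ ⋊ C₄) × C_n` -/

section Field

variable {K : Type} [Field K] [NumberField K] [IsCMField K] [IsGalois ℚ K]

/-- **`Gal(K/ℚ) ≅ (C₄ ⋊ C₄) × C_n`** (`φ(1) = (·)⁻¹`), complex conjugation `c = (x² y^{2s₀}, 1)`, with an aperiodic `θ`-asymmetric CM half of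
`(ℤ/4 × ℤ/2) × ℤ/n` (`A = ⟨x⟩ × ⟨y²⟩`, `θ(t,s,v) = (−t,s,v)`, half given as a decidable predicate) ⟹ **BAD**: a simple DEGENERATE abelian
variety of dimension `8n` with CM by `K` — the doubled type `i(S) ⊔ i(S)·y`, degenerate because `c ∉ ⟨y²⟩`.
[cite: Kubota1965, §2 and §4 Lemma 2] [cite: Shimura1998, §6.2 Thm. 3 and §8.2 Prop. 26] [cite: Gordon1999HodgeAVSurvey, Thm. 6.4 and §9.3] -/
theorem exists_simple_degenerate_fourSemidirectFour_times_cyclic_of_half {n : ℕ} [NeZero n]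
    (φ : Multiplicative (ZMod 4) →* MulAut (Multiplicative (ZMod 4))) (hφ : ∀ t, φ (Multiplicative.ofAdd 1) t = t⁻¹)
    (e : (K ≃ₐ[ℚ] K) ≃* (Multiplicative (ZMod 4) ⋊[φ] Multiplicative (ZMod 4)) × Multiplicative (ZMod n))
    (s₀ : ZMod 2) (hc : e ((IsCMField.complexConj K).restrictScalars ℚ) =
      (SemidirectProduct.inl (Multiplicative.ofAdd 2) * SemidirectProduct.inr (Multiplicative.ofAdd (2 * (s₀.val : ZMod 4))), 1))
    (P : (ZMod 4 × ZMod 2) × ZMod n → Prop) [DecidablePred P] (hP : ∀ s, P s ↔ ¬ P (((2, s₀), 0) + s))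
    (haper : ∀ a : (ZMod 4 × ZMod 2) × ZMod n, a ≠ 0 → ∃ s, ¬ (P s ↔ P (a + s)))
    (hasym : ∀ a : (ZMod 4 × ZMod 2) × ZMod n, ∃ s, ¬ (P s ↔ P (a + ((-s.1.1, s.1.2), s.2)))) :
    ∃ (Φ : CMType K) (φ₀ : K →+* ℂ) (X : AbelianVariety ℂ) (ι : 𝓞 K →+* End X)
      (ϑ : K →+* Module.End ℂ (complexBetti X.X 1)),
      IsPrimitive (ℂ ≃+* ℂ) Φ.1 φ₀ ∧ ¬ IsNondegenerate Φ ∧ IsCMTypeRealisation Φ X ι ϑ ∧ X.IsSimple ∧ X.dim = 8 * n ∧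
      ∃ m q : ℕ, ∃ y : complexBetti (⨁ fun _ : Fin m => X).X (2 * q), IsRationalClass y ∧
        IsOfHodgeType (⨁ fun _ : Fin m => X).dim (⨁ fun _ : Fin m => X).X (2 * q) q q y ∧
        y ∉ divisorClassesSpan (⨁ fun _ : Fin m => X).X (⨁ fun _ : Fin m => X).dim q := by
  classical
  haveI : Fintype (Multiplicative (ZMod 4) ⋊[φ] Multiplicative (ZMod 4)) := Fintype.ofEquiv _ SemidirectProduct.equivProd.symm
  have hcard : Fintype.card (Multiplicative (ZMod 4) ⋊[φ] Multiplicative (ZMod 4)) = 16 := by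
    rw [Fintype.card_congr SemidirectProduct.equivProd, Fintype.card_prod, Fintype.card_multiplicative, ZMod.card]
  -- the doubling `d : ℤ/2 → ℤ/4` and the action facts `φ(y²) = id`
  have hd_add : ∀ s s' : ZMod 2, (2 * ((s + s').val : ZMod 4)) = 2 * (s.val : ZMod 4) + 2 * (s'.val : ZMod 4) := by decide
  have hd_ne : ∀ s : ZMod 2, Multiplicative.ofAdd (2 * (s.val : ZMod 4)) ≠ Multiplicative.ofAdd 1 := by decide
  have hd_inj : ∀ s s' : ZMod 2, (2 * (s.val : ZMod 4)) = 2 * (s'.val : ZMod 4) → s = s' := by decide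
  have hφ2 : ∀ t, φ (Multiplicative.ofAdd 2) t = t := fun t => by
    rw [show Multiplicative.ofAdd (2 : ZMod 4) = Multiplicative.ofAdd 1 * Multiplicative.ofAdd 1 from rfl, map_mul,
      MulAut.mul_apply, hφ, hφ, inv_inv]
  have hφd : ∀ (s : ZMod 2) (t : Multiplicative (ZMod 4)), φ (Multiplicative.ofAdd (2 * (s.val : ZMod 4))) t = t := by
    intro s t
    rcases (by decide : ∀ s : ZMod 2, s = 0 ∨ s = 1) s with rfl | rfl
    · rw [ZMod.val_zero, Nat.cast_zero, mul_zero, ofAdd_zero, map_one, MulAut.one_apply]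
    · rw [show ((1 : ZMod 2).val : ZMod 4) = 1 from rfl, mul_one, hφ2]
  have hcomm : ∀ (s : ZMod 2) (a : Multiplicative (ZMod 4)),
      (SemidirectProduct.inr (Multiplicative.ofAdd (2 * (s.val : ZMod 4))) : Multiplicative (ZMod 4) ⋊[φ] Multiplicative (ZMod 4)) *
        SemidirectProduct.inl a = SemidirectProduct.inl a * SemidirectProduct.inr (Multiplicative.ofAdd (2 * (s.val : ZMod 4))) := by
    intro s a
    conv_rhs => rw [← hφd s a, SemidirectProduct.inl_aut, map_inv, inv_mul_cancel_right]
  -- the embedding `i(t, s, v) = (xᵗ y^{2s}, v)` of `A = ℤ/4 × ℤ/2 × ℤ/n`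
  let i₀ : Multiplicative (ZMod 4 × ZMod 2) → Multiplicative (ZMod 4) ⋊[φ] Multiplicative (ZMod 4) := fun w =>
    SemidirectProduct.inl (Multiplicative.ofAdd (Multiplicative.toAdd w).1) *
      SemidirectProduct.inr (Multiplicative.ofAdd (2 * ((Multiplicative.toAdd w).2.val : ZMod 4)))
  have hi₀_mul : ∀ w w', i₀ (w * w') = i₀ w * i₀ w' := by
    intro w w'
    simp only [i₀, toAdd_mul, Prod.fst_add, Prod.snd_add, hd_add, ofAdd_add, map_mul]
    rw [mul_assoc, mul_assoc, ← mul_assoc (SemidirectProduct.inr _) (SemidirectProduct.inl _), hcomm, mul_assoc]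
  let i : Multiplicative (ZMod 4 × ZMod 2) × Multiplicative (ZMod n) →*
      (Multiplicative (ZMod 4) ⋊[φ] Multiplicative (ZMod 4)) × Multiplicative (ZMod n) :=
    MonoidHom.mk' (fun w => (i₀ w.1, w.2)) fun w w' => by rw [Prod.fst_mul, Prod.snd_mul, hi₀_mul]; rfl
  have hi_apply : ∀ w v, i (w, v) = (i₀ w, v) := fun w v => rfl
  have hi₀_right : ∀ w, (i₀ w).right = Multiplicative.ofAdd (2 * ((Multiplicative.toAdd w).2.val : ZMod 4)) := fun w => by
    simp only [i₀, SemidirectProduct.mul_right, SemidirectProduct.right_inl, SemidirectProduct.right_inr, one_mul]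
  have hi₀_left : ∀ w, (i₀ w).left = Multiplicative.ofAdd (Multiplicative.toAdd w).1 := fun w => by
    simp only [i₀, SemidirectProduct.mul_left, SemidirectProduct.left_inl, SemidirectProduct.right_inl, SemidirectProduct.left_inr,
      map_one, mul_one]
  have hi : Function.Injective i := by
    rintro ⟨w, v⟩ ⟨w', v'⟩ h
    rw [hi_apply, hi_apply, Prod.mk.injEq] at h
    have h1 := congrArg SemidirectProduct.left h.1
    have h2 := congrArg SemidirectProduct.right h.1
    rw [hi₀_left, hi₀_left] at h1
    rw [hi₀_right, hi₀_right] at h2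
    refine Prod.ext (Multiplicative.toAdd.injective (Prod.ext (by simpa using h1) (hd_inj _ _ (by simpa using h2)))) h.2
  set y₁ : Multiplicative (ZMod 4) := Multiplicative.ofAdd 1 with hy₁_def
  set x : (Multiplicative (ZMod 4) ⋊[φ] Multiplicative (ZMod 4)) × Multiplicative (ZMod n) := (SemidirectProduct.inr y₁, 1)
    with hx_def
  have hx : ∀ w, i w ≠ x := fun ⟨w, v⟩ h => by
    have h1 := congrArg (fun z => SemidirectProduct.right z.1) h
    simp only [hi_apply, hx_def, hi₀_right, SemidirectProduct.right_inr] at h1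
    exact hd_ne _ h1
  have hcov : ∀ g : (Multiplicative (ZMod 4) ⋊[φ] Multiplicative (ZMod 4)) × Multiplicative (ZMod n),
      (∃ w, g = i w) ∨ (∃ w, g = i w * x) := by
    rintro ⟨⟨a, b⟩, v⟩
    have key : ∀ b : Multiplicative (ZMod 4), ∃ s : ZMod 2, b = Multiplicative.ofAdd (2 * (s.val : ZMod 4)) ∨
        b = Multiplicative.ofAdd (2 * (s.val : ZMod 4)) * Multiplicative.ofAdd 1 := by decide
    obtain ⟨s, hs | hs⟩ := key b
    · refine Or.inl ⟨(Multiplicative.ofAdd (Multiplicative.toAdd a, s), v), ?_⟩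
      rw [hi_apply, SemidirectProduct.mk_eq_inl_mul_inr, hs]
      simp only [i₀, toAdd_ofAdd, ofAdd_toAdd]
    · refine Or.inr ⟨(Multiplicative.ofAdd (Multiplicative.toAdd a, s), v), ?_⟩
      rw [hi_apply, hx_def, Prod.mk_mul_mk, mul_one, SemidirectProduct.mk_eq_inl_mul_inr, hs, map_mul, ← mul_assoc, hy₁_def]
      simp only [i₀, toAdd_ofAdd, ofAdd_toAdd]
  let θ : Multiplicative (ZMod 4 × ZMod 2) × Multiplicative (ZMod n) ≃* Multiplicative (ZMod 4 × ZMod 2) × Multiplicative (ZMod n) :=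
    MulEquiv.prodCongr ((AddEquiv.prodCongr (AddEquiv.neg (ZMod 4)) (AddEquiv.refl (ZMod 2))).toMultiplicative) (MulEquiv.refl _)
  have hθ_apply : ∀ w, θ w = (Multiplicative.ofAdd (-(Multiplicative.toAdd w.1).1, (Multiplicative.toAdd w.1).2), w.2) :=
    fun w => rfl
  have hyx : ∀ a : Multiplicative (ZMod 4), (SemidirectProduct.inr y₁ : Multiplicative (ZMod 4) ⋊[φ] Multiplicative (ZMod 4)) *
      SemidirectProduct.inl a = SemidirectProduct.inl a⁻¹ * SemidirectProduct.inr y₁ := fun a => by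
    rw [hy₁_def, ← hφ, SemidirectProduct.inl_aut, map_inv, inv_mul_cancel_right]
  have hyy : ∀ b : Multiplicative (ZMod 4), (SemidirectProduct.inr y₁ : Multiplicative (ZMod 4) ⋊[φ] Multiplicative (ZMod 4)) *
      SemidirectProduct.inr b = SemidirectProduct.inr b * SemidirectProduct.inr y₁ := fun b => by
    rw [← map_mul SemidirectProduct.inr, ← map_mul SemidirectProduct.inr, mul_comm]
  have hθ : ∀ w, x * i w = i (θ w) * x := fun ⟨w, v⟩ => by
    rw [hi_apply, hθ_apply, hi_apply, hx_def, Prod.mk_mul_mk, one_mul, Prod.mk_mul_mk, mul_one]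
    refine Prod.ext ?_ rfl
    change SemidirectProduct.inr y₁ * i₀ w = i₀ _ * SemidirectProduct.inr y₁
    simp only [i₀, toAdd_ofAdd]
    rw [← mul_assoc, hyx, mul_assoc, hyy, ← mul_assoc, ofAdd_neg]
  set q : Multiplicative (ZMod 4 × ZMod 2) × Multiplicative (ZMod n) := (Multiplicative.ofAdd (0, 1), 1) with hq_def
  have hq : x * x = i q := by
    rw [hx_def, Prod.mk_mul_mk, mul_one, hq_def, hi_apply, ← map_mul]
    refine Prod.ext ?_ rfl
    change SemidirectProduct.inr (y₁ * y₁) = i₀ _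
    simp only [i₀, toAdd_ofAdd, ofAdd_zero, map_one, one_mul]
    rfl
  set c : Multiplicative (ZMod 4 × ZMod 2) × Multiplicative (ZMod n) := (Multiplicative.ofAdd (2, s₀), 1) with hc_def
  have hic : i c = (SemidirectProduct.inl (Multiplicative.ofAdd 2) *
      SemidirectProduct.inr (Multiplicative.ofAdd (2 * (s₀.val : ZMod 4))), 1) := by
    rw [hc_def, hi_apply]
    simp only [i₀, toAdd_ofAdd]
  have hcq : c ∉ Subgroup.zpowers q := by
    rw [Subgroup.mem_zpowers_iff]
    rintro ⟨k, hk⟩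
    have h1 := congrArg (fun z => (Multiplicative.toAdd z.1).1) hk
    simp only [hq_def, hc_def, Prod.pow_fst, toAdd_zpow, toAdd_ofAdd, Prod.smul_fst, smul_zero] at h1
    exact absurd h1 (by decide)
  have hcc : c * c = 1 := by
    rw [hc_def, Prod.mk_mul_mk, mul_one, ← ofAdd_add, Prod.mk_add_mk]
    refine Prod.ext ?_ rfl
    change Multiplicative.ofAdd ((2 : ZMod 4) + 2, s₀ + s₀) = 1
    rw [show (2 : ZMod 4) + 2 = 0 by decide, show s₀ + s₀ = 0 from by rcases (by decide : ∀ s : ZMod 2, s = 0 ∨ s = 1) s₀ with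
      rfl | rfl <;> decide]
    rfl
  have hθc : θ c = c := by
    rw [hθ_apply, hc_def]
    refine Prod.ext ?_ rfl
    change Multiplicative.ofAdd (-(2 : ZMod 4), s₀) = Multiplicative.ofAdd (2, s₀)
    rw [show -(2 : ZMod 4) = 2 by decide]
  set S : Finset (Multiplicative (ZMod 4 × ZMod 2) × Multiplicative (ZMod n)) :=
    Finset.univ.filter fun w => P (Multiplicative.toAdd w.1, Multiplicative.toAdd w.2) with hS_def
  have hSmem : ∀ w : Multiplicative (ZMod 4 × ZMod 2) × Multiplicative (ZMod n),
      w ∈ S ↔ P (Multiplicative.toAdd w.1, Multiplicative.toAdd w.2) := fun w => by simp [hS_def]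
  have hS : ∀ a, a ∈ S ↔ c * a ∉ S := fun a => by
    rw [hSmem, hSmem, hc_def, Prod.fst_mul, Prod.snd_mul, one_mul, toAdd_mul, toAdd_ofAdd, hP]
    simp only [Prod.mk_add_mk, zero_add]
  have haper' : ∀ a : Multiplicative (ZMod 4 × ZMod 2) × Multiplicative (ZMod n), a ≠ 1 → ∃ s, ¬ (s ∈ S ↔ a * s ∈ S) := by
    intro a ha
    have ha' : (Multiplicative.toAdd a.1, Multiplicative.toAdd a.2) ≠ (0 : (ZMod 4 × ZMod 2) × ZMod n) := by
      intro h
      apply ha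
      rw [Prod.mk_eq_zero] at h
      exact Prod.ext (toAdd_eq_zero.1 h.1) (toAdd_eq_zero.1 h.2)
    obtain ⟨⟨s₁, s₂⟩, hs⟩ := haper _ ha'
    refine ⟨(Multiplicative.ofAdd s₁, Multiplicative.ofAdd s₂), ?_⟩
    simpa only [hSmem, Prod.fst_mul, Prod.snd_mul, toAdd_mul, toAdd_ofAdd, Prod.mk_add_mk] using hs
  have hasym' : ∀ a : Multiplicative (ZMod 4 × ZMod 2) × Multiplicative (ZMod n), ∃ s, ¬ (s ∈ S ↔ a * θ s ∈ S) := by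
    intro a
    obtain ⟨⟨s₁, s₂⟩, hs⟩ := hasym (Multiplicative.toAdd a.1, Multiplicative.toAdd a.2)
    refine ⟨(Multiplicative.ofAdd s₁, Multiplicative.ofAdd s₂), ?_⟩
    simpa only [hSmem, hθ_apply, Prod.fst_mul, Prod.snd_mul, toAdd_mul, toAdd_ofAdd, Prod.mk_add_mk] using hs
  obtain ⟨Φ, φ₀, X, ι, ϑ, h1, h2, h3, h4, h5, h6⟩ := exists_simple_degenerate_of_index_two_doubled e i hi x hx hcov θ hθ q hq hcq
    hcc hθc (by rw [hic]; exact hc) S hS haper' hasym'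
  refine ⟨Φ, φ₀, X, ι, ϑ, h1, h2, h3, h4, ?_, h6⟩
  rw [h5, Fintype.card_prod, hcard, Fintype.card_multiplicative, ZMod.card]
  omega

/-! ## §2 All degrees `n ≥ 3`: `c = x²` and `c = x²y²` -/

/-- **`(C₄ ⋊ C₄) × C_n` with complex conjugation `c = (x² y^{2s₀}, 1)` (`s₀ = 0`: `c = x²`; `s₀ = 1`: `c = x²y²`) is BAD for every
`n ≥ 3`** — non-split doubled type of the two-halves fibre half `H₁ = {(0,0),(0,1),(1,0),(1,1)}`,
`H₂ = {(1,1),(2,0),(2,1),(3,s₀)}` over `v = 1`. [cite: Kubota1965, §2 and §4 Lemma 2] [cite: Shimura1998, §6.2 Thm. 3 and §8.2 Prop. 26]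
[cite: Gordon1999HodgeAVSurvey, Thm. 6.4 and §9.3] -/
theorem exists_simple_degenerate_fourSemidirectFour_times_cyclic {n : ℕ} [NeZero n] (hn : 3 ≤ n)
    (φ : Multiplicative (ZMod 4) →* MulAut (Multiplicative (ZMod 4))) (hφ : ∀ t, φ (Multiplicative.ofAdd 1) t = t⁻¹)
    (e : (K ≃ₐ[ℚ] K) ≃* (Multiplicative (ZMod 4) ⋊[φ] Multiplicative (ZMod 4)) × Multiplicative (ZMod n))
    (s₀ : ZMod 2) (hc : e ((IsCMField.complexConj K).restrictScalars ℚ) =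
      (SemidirectProduct.inl (Multiplicative.ofAdd 2) * SemidirectProduct.inr (Multiplicative.ofAdd (2 * (s₀.val : ZMod 4))), 1)) :
    ∃ (Φ : CMType K) (φ₀ : K →+* ℂ) (X : AbelianVariety ℂ) (ι : 𝓞 K →+* End X)
      (ϑ : K →+* Module.End ℂ (complexBetti X.X 1)),
      IsPrimitive (ℂ ≃+* ℂ) Φ.1 φ₀ ∧ ¬ IsNondegenerate Φ ∧ IsCMTypeRealisation Φ X ι ϑ ∧ X.IsSimple ∧ X.dim = 8 * n ∧
      ∃ m q : ℕ, ∃ y : complexBetti (⨁ fun _ : Fin m => X).X (2 * q), IsRationalClass y ∧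
        IsOfHodgeType (⨁ fun _ : Fin m => X).dim (⨁ fun _ : Fin m => X).X (2 * q) q q y ∧
        y ∉ divisorClassesSpan (⨁ fun _ : Fin m => X).X (⨁ fun _ : Fin m => X).dim q := by
  classical
  rcases (by decide : ∀ s : ZMod 2, s = 0 ∨ s = 1) s₀ with rfl | rfl
  · exact exists_simple_degenerate_fourSemidirectFour_times_cyclic_of_half φ hφ e 0 hc
      (fun s => if s.2 = 1 then s.1 ∈ ({(1,1), (2,0), (2,1), (3,0)} : Finset (ZMod 4 × ZMod 2))
        else s.1 ∈ ({(0,0), (0,1), (1,0), (1,1)} : Finset (ZMod 4 × ZMod 2)))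
      (TwoHalves.fibre_cm _ _ (2, 0) (by decide) (by decide))
      (TwoHalves.fibre_aperiodic hn _ _ (by decide) (by decide))
      (TwoHalves.fibre_asymmetric hn (fun w : ZMod 4 × ZMod 2 => (-w.1, w.2)) (by decide) _ _ (by decide) (by decide))
  · exact exists_simple_degenerate_fourSemidirectFour_times_cyclic_of_half φ hφ e 1 hc
      (fun s => if s.2 = 1 then s.1 ∈ ({(1,1), (2,0), (2,1), (3,1)} : Finset (ZMod 4 × ZMod 2))
        else s.1 ∈ ({(0,0), (0,1), (1,0), (1,1)} : Finset (ZMod 4 × ZMod 2)))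
      (TwoHalves.fibre_cm _ _ (2, 1) (by decide) (by decide))
      (TwoHalves.fibre_aperiodic hn _ _ (by decide) (by decide))
      (TwoHalves.fibre_asymmetric hn (fun w : ZMod 4 × ZMod 2 => (-w.1, w.2)) (by decide) _ _ (by decide) (by decide))

/-- The two clean forms: `c = (x², 1)` and `c = (x²y², 1)`, every `n ≥ 3`. [cite: Kubota1965, §2 and §4 Lemma 2] -/
theorem exists_simple_degenerate_fourSemidirectFour_times_cyclic_sq {n : ℕ} [NeZero n] (hn : 3 ≤ n)
    (φ : Multiplicative (ZMod 4) →* MulAut (Multiplicative (ZMod 4))) (hφ : ∀ t, φ (Multiplicative.ofAdd 1) t = t⁻¹)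
    (e : (K ≃ₐ[ℚ] K) ≃* (Multiplicative (ZMod 4) ⋊[φ] Multiplicative (ZMod 4)) × Multiplicative (ZMod n))
    (hc : e ((IsCMField.complexConj K).restrictScalars ℚ) = (SemidirectProduct.inl (Multiplicative.ofAdd 2), 1) ∨
      e ((IsCMField.complexConj K).restrictScalars ℚ) =
        (SemidirectProduct.inl (Multiplicative.ofAdd 2) * SemidirectProduct.inr (Multiplicative.ofAdd 2), 1)) :
    ∃ (Φ : CMType K) (φ₀ : K →+* ℂ) (X : AbelianVariety ℂ) (ι : 𝓞 K →+* End X)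
      (ϑ : K →+* Module.End ℂ (complexBetti X.X 1)),
      IsPrimitive (ℂ ≃+* ℂ) Φ.1 φ₀ ∧ ¬ IsNondegenerate Φ ∧ IsCMTypeRealisation Φ X ι ϑ ∧ X.IsSimple ∧ X.dim = 8 * n ∧
      ∃ m q : ℕ, ∃ y : complexBetti (⨁ fun _ : Fin m => X).X (2 * q), IsRationalClass y ∧
        IsOfHodgeType (⨁ fun _ : Fin m => X).dim (⨁ fun _ : Fin m => X).X (2 * q) q q y ∧
        y ∉ divisorClassesSpan (⨁ fun _ : Fin m => X).X (⨁ fun _ : Fin m => X).dim q := by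
  rcases hc with hc | hc
  · exact exists_simple_degenerate_fourSemidirectFour_times_cyclic hn φ hφ e 0
      (by rw [hc, ZMod.val_zero, Nat.cast_zero, mul_zero, ofAdd_zero, map_one, mul_one])
  · exact exists_simple_degenerate_fourSemidirectFour_times_cyclic hn φ hφ e 1
      (by rw [hc, show ((1 : ZMod 2).val : ZMod 4) = 1 from rfl, mul_one])

end Field

end Summit.HodgeConjecture.CorCM.SplitInvolution

end
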